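import Summits.Ventures.YMGap.RobustBall.UniformMassGap
import Summits.Ventures.YMGap.RobustBall.PlaquettePositivityOneLink
import Summits.Ventures.YMGap.RobustBall.HaarSecondMoments
import Literature.MathematicalPhysics.QuantumFieldTheory.Sweep1ShenZhuZhuProofs
import HarnessLib

/-!
# Venture YMGap, track ROBUST-BALL (Y2) — a UNIFORM FLOOR for the plaquette fluctuations on the tier-1 ball, at EVERY coupling

HONEST FRAMING. WHAT THIS IS: a venture file (cell `pub-ymgap`, track Y2 ROBUST-BALL, seat rb-p1, theorems only). The uniform
susceptibility bounds of `UniformPlaquetteSusceptibility.lean` bound `Σ_q |Cov_μ(W_p, W_q)|` from ABOVE inside the certified balls.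
Here is the complementary statement from BELOW, valid at EVERY coupling and for EVERY member of the tier-1 ball with oscillation load
`ε₀` (no smallness, no door): the single-plaquette variance has a uniform floor,
`Var_μ(W_p) ≥ e^{−(4(d−1)N²|β| + ε₀)} · V₀/N²` (`W_p = (1/N) Re tr U_p`, `V₀ = charVariance`, 't Hooft `β`, bare coupling `Nβ`),
for EVERY DLR state `μ` of the member (`variance_plaquette_ge_of_memBallZd`). Mechanism (rb-p2's plaquette-positivity parts I–II,
read for the variance): the DLR equation at ONE link `e` of `p` (`le_integral_of_isGibbsMeasure`), the member's one-link law = Haar tilted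
by an energy of oscillation `≤ 4(d−1)N²|β| + ε₀` (`siteLaw_perturbedYM_eq_tilted_haar`, `exp_neg_mul_integral_le_integral_tilted`), and the
Haar identity `∫ (A + Re tr ρ(g s))² dg = A² + V₀` (`integral_add_reTr_sq`). Cells: the Wilson point (`ε₀ = 0`, every `β`, every DLR
state: `variance_plaquette_ge_wilson`), `SU(2)` `d = 4`: `Var_μ(½ Re tr U_p) ≥ e^{−12|β_W| − ε₀}/4` on the ball and `≥ e^{−12|β_W|}/4` at the
Wilson point (`su2_variance_plaquette_ge[_wilson]`); every `N ≥ 2`: `≥ e^{−(4(d−1)N²|β| + ε₀)}/(2N²)`.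
READING: together with the uniform susceptibility ceiling, the plaquette fluctuations on the ball are bracketed from both sides —
non-degenerate and summable. WHAT THIS IS NOT: a lattice statement at every coupling; nothing about the continuum or Clay.
-/

noncomputable section

open MeasureTheory Filter Function ProbabilityTheory Real
open scoped NNReal
open Literature.Probability.LatticeModels
open Literature.Probability.LatticeModels.DobrushinMetric
open Literature.MathematicalPhysics.QuantumLattice
open Literature.MathematicalPhysics.QuantumFieldTheory hiding ZdEdge Site

namespace Summit.Ventures.YMGap.RobustBall

variable {d N : ℕ}

/-! ### The Haar mean of the squared deviation of a plaquette on the one-link fibre -/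

/-- On the one-link fibre at a link `e` of the plaquette `p`, the normalised plaquette reads `(1/N) Re tr(ρ(g)·ρ(staple))`
(`re_trace_holonomy_update`; the two plaquette holonomies agree by definition). [folklore] -/
theorem zdPlaquetteObs_update_eq {p : ZdPlaquette d} {e : ZdEdge d} (he : e ∈ plaquetteEdges p)
    (ω : LGConfig d (SUN N)) (g : SUN N) :
    zdPlaquetteObs (fundamentalRep (Fin N)) p.1 p.2.1.1 p.2.1.2 (Function.update ω e g) =
      (N : ℝ)⁻¹ * (fundamentalRep (Fin N) g * fundamentalRep (Fin N) (staple p e ω)).trace.re := by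
  unfold zdPlaquetteObs
  rw [← re_trace_holonomy_update (fundamentalRep (Fin N)) fundamentalRep_mem_unitaryGroup he ω g]
  rfl

/-- **The Haar second moment about any constant is at least `V₀/N²`**: for `N ≥ 2`, every plaquette `p ∋ e`, boundary condition `ω` and
constant `m`: `∫ (W_p(ω^{e←g}) − m)² dg = m² + V₀/N² ≥ V₀/N²` (`integral_add_reTr_sq` with `A = −N m`). [folklore] -/
theorem integral_haar_sq_sub_ge (hN : 2 ≤ N) {p : ZdPlaquette d} {e : ZdEdge d} (he : e ∈ plaquetteEdges p)
    (ω : LGConfig d (SUN N)) (m : ℝ) :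
    PlaquetteLowerBound.charVariance (fundamentalRep (Fin N)) / (N : ℝ) ^ 2 ≤
      ∫ g, (zdPlaquetteObs (fundamentalRep (Fin N)) p.1 p.2.1.1 p.2.1.2 (Function.update ω e g) - m) ^ 2 ∂haarProbability (SUN N) := by
  have hN0 : (N : ℝ) ≠ 0 := by exact_mod_cast (show N ≠ 0 by omega)
  have hρ := TorusAreaLaw.isSpecialUnitaryModel_fundamentalRep N
  have hkey := PlaquettePositivity.integral_add_reTr_sq (fundamentalRep (Fin N)) hρ hN (-(N : ℝ) * m) 1 (staple p e ω)
  have hfun : (fun g : SUN N => (zdPlaquetteObs (fundamentalRep (Fin N)) p.1 p.2.1.1 p.2.1.2 (Function.update ω e g) - m) ^ 2) =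
      fun g => ((N : ℝ) ^ 2)⁻¹ * (-(N : ℝ) * m + (fundamentalRep (Fin N) (1 * g * staple p e ω)).trace.re) ^ 2 := by
    funext g
    rw [zdPlaquetteObs_update_eq he, one_mul, map_mul]
    field_simp
    ring
  rw [hfun, integral_const_mul, hkey]
  have hsq : (0 : ℝ) ≤ (-(N : ℝ) * m) ^ 2 := sq_nonneg _
  rw [div_eq_mul_inv, mul_comm]
  exact mul_le_mul_of_nonneg_left (le_add_of_nonneg_left hsq) (by positivity)

/-! ### The floor for a member of the tier-1 ball -/

section Member

variable {β ε₀ ε₁ R : ℝ} {W : Potential (ZdEdge d) (SUN N)} {supp : Finset (ZdEdge d) → Finset (Finset (ZdEdge d))}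

/-- **Oscillation of the member's one-link energy**: for a member of `MemBallZd ε₀ ε₁ R` at 't Hooft coupling `β`, the tilt
`g ↦ perturbedEnergy (Nβ) W supp {e} (ω^{e←g})` of the one-link law varies by at most `4(d−1)N²|β| + ε₀` (Wilson part
`Nβ Σ_{p∋e} Re tr(ρ(g) ρ(staple))`, `|Σ| ≤ 2(d−1)N`; perturbation part `≤` the oscillation load). [folklore] -/
theorem perturbedEnergy_singleton_osc (hd : 1 ≤ d) (hW : MemBallZd ε₀ ε₁ R W supp) (e : ZdEdge d) (ω : LGConfig d (SUN N))
    (g g' : SUN N) :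
    perturbedEnergy (fundamentalRep (Fin N)) (N * β) W supp {e} (Function.update ω e g) ≤
      perturbedEnergy (fundamentalRep (Fin N)) (N * β) W supp {e} (Function.update ω e g') +
        (4 * ((d : ℝ) - 1) * (N : ℝ) ^ 2 * |β| + ε₀) := by
  obtain ⟨osc, lip, hosc, -, hosca, -⟩ := hW.loads
  have hu := fundamentalRep_mem_unitaryGroup (n := Fin N)
  have hH := hamiltonianIn_singleton_update_osc (supp := supp) hosc e ω g' g
  have hload := hosca e
  unfold perturbedEnergy
  rw [wilsonBoundaryAction_singleton_update (fundamentalRep (Fin N)) hu e ω g,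
    wilsonBoundaryAction_singleton_update (fundamentalRep (Fin N)) hu e ω g', Finset.sum_sub_distrib, Finset.sum_sub_distrib]
  have hS := PlaquettePositivity.abs_sum_re_trace_staple_le (fundamentalRep (Fin N)) hu e ω g
  have hS' := PlaquettePositivity.abs_sum_re_trace_staple_le (fundamentalRep (Fin N)) hu e ω g'
  have hcard : ((plaquettesTouching {e}).card : ℝ) ≤ 2 * ((d : ℝ) - 1) := by
    have h := card_plaquettesTouching_singleton_le e
    have h' : ((plaquettesTouching {e}).card : ℝ) ≤ ((2 * (d - 1) : ℕ) : ℝ) := by exact_mod_cast h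
    rw [Nat.cast_mul, Nat.cast_sub hd] at h'
    simpa using h'
  have hN0 : (0 : ℝ) ≤ N := Nat.cast_nonneg _
  have hdiff : |(N * β) * (∑ p ∈ plaquettesTouching {e}, (fundamentalRep (Fin N) g * fundamentalRep (Fin N) (staple p e ω)).trace.re -
      ∑ p ∈ plaquettesTouching {e}, (fundamentalRep (Fin N) g' * fundamentalRep (Fin N) (staple p e ω)).trace.re)| ≤
      4 * ((d : ℝ) - 1) * (N : ℝ) ^ 2 * |β| := by
    rw [abs_mul, abs_mul, Nat.abs_cast]
    have h2 : |∑ p ∈ plaquettesTouching {e}, (fundamentalRep (Fin N) g * fundamentalRep (Fin N) (staple p e ω)).trace.re -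
        ∑ p ∈ plaquettesTouching {e}, (fundamentalRep (Fin N) g' * fundamentalRep (Fin N) (staple p e ω)).trace.re| ≤
        2 * (2 * ((d : ℝ) - 1) * N) := by
      refine (abs_sub _ _).trans ?_
      have := mul_le_mul_of_nonneg_right hcard hN0
      linarith
    calc (N : ℝ) * |β| * _ ≤ (N : ℝ) * |β| * (2 * (2 * ((d : ℝ) - 1) * N)) := by gcongr
      _ = 4 * ((d : ℝ) - 1) * (N : ℝ) ^ 2 * |β| := by ring
  have hlin := (abs_le.1 hdiff).1
  have hlin' := (abs_le.1 hdiff).2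
  nlinarith [hH, hload, hlin, hlin']

/-- **THE UNIFORM VARIANCE FLOOR ON THE TIER-1 BALL, EVERY COUPLING**: for `d ≥ 2`, `N ≥ 2`, any 't Hooft `β`, every member `(W, supp)` of
`MemBallZd ε₀ ε₁ R`, every DLR state `μ` and every plaquette `p`:
`Var_μ(W_p) ≥ e^{−(4(d−1)N²|β| + ε₀)} · V₀/N²` (`V₀ = charVariance (fundamentalRep (Fin N)) ≥ 1/2`). [folklore] -/
theorem variance_plaquette_ge_of_memBallZd (hd : 2 ≤ d) (hN : 2 ≤ N) (hW : MemBallZd ε₀ ε₁ R W supp)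
    {μ : Measure (LGConfig d (SUN N))} (hμ : μ ∈ perturbedGibbsMeasures (d := d) (fundamentalRep (Fin N)) (N * β) W supp)
    (p : ZdPlaquette d) :
    Real.exp (-(4 * ((d : ℝ) - 1) * (N : ℝ) ^ 2 * |β| + ε₀)) * (PlaquetteLowerBound.charVariance (fundamentalRep (Fin N)) / (N : ℝ) ^ 2) ≤
      Var[zdPlaquetteObs (fundamentalRep (Fin N)) p.1 p.2.1.1 p.2.1.2; μ] := by
  classical
  haveI : SecondCountableTopology (Matrix (Fin N) (Fin N) ℂ) := inferInstanceAs (SecondCountableTopology (Fin N → Fin N → ℂ))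
  haveI : SecondCountableTopology (SUN N) := Topology.IsEmbedding.subtypeVal.secondCountableTopology
  have hd1 : 1 ≤ d := by omega
  have hρc : Continuous (fundamentalRep (Fin N)) := continuous_fundamentalRep (Fin N)
  have hWm : ∀ X, Measurable (W X) := fun X => (hW.continuous X).measurable
  have hWa : W.IsAdapted := fun X => ⟨hW.dependsOn X, hWm X⟩
  have hWb : ∀ X, ∃ C, ∀ U, |W X U| ≤ C := fun X => exists_bound_of_continuous (hW.continuous X)
  have hγ : IsSpecification (perturbedYM (d := d) (fundamentalRep (Fin N)) (N * β) W supp) :=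
    isSpecification_perturbedYM _ hρc _ hWa hWb hW.supportedBy
  have hμ' : IsGibbsMeasure (perturbedYM (d := d) (fundamentalRep (Fin N)) (N * β) W supp) μ := hμ
  haveI := hμ'.isProbabilityMeasure
  -- the observable and its deviation from the (fixed) mean
  set F : LGConfig d (SUN N) → ℝ := zdPlaquetteObs (fundamentalRep (Fin N)) p.1 p.2.1.1 p.2.1.2 with hF
  have hFm : Measurable F := (isLipschitzCylinder_zdPlaquetteObs p.1 p.2.2).measurable
  have hF1 : ∀ U, |F U| ≤ 1 := fun U => abs_zdPlaquetteObs_le fundamentalRep_mem_unitaryGroup _ _ _ U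
  set m : ℝ := ∫ U, F U ∂μ with hm
  have hm1 : |m| ≤ 1 := by
    have h := norm_integral_le_of_norm_le_const (μ := μ) (f := F) (C := 1) (ae_of_all _ fun U => by
      rw [Real.norm_eq_abs]; exact hF1 U)
    simpa [Real.norm_eq_abs] using h
  set X : LGConfig d (SUN N) → ℝ := fun U => (F U - m) ^ 2 with hX
  have hXm : Measurable X := (hFm.sub measurable_const).pow_const 2
  have hX0 : ∀ U, 0 ≤ X U := fun U => sq_nonneg _
  have hX4 : ∀ U, X U ≤ 4 := fun U => by
    have h1 := hF1 U
    have : |F U - m| ≤ 2 := (abs_sub _ _).trans (by linarith)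
    calc X U = |F U - m| ^ 2 := by rw [hX, sq_abs]
      _ ≤ 2 ^ 2 := pow_le_pow_left₀ (abs_nonneg _) this 2
      _ = 4 := by norm_num
  have hXabs : ∀ U, |X U| ≤ 4 := fun U => by rw [abs_of_nonneg (hX0 U)]; exact hX4 U
  -- the variance is the mean of `X`
  rw [variance_eq_integral hFm.aemeasurable]
  change _ ≤ ∫ U, X U ∂μ
  -- a link of the plaquette
  set e : ZdEdge d := (p.1, p.2.1.1) with he
  have hep : e ∈ plaquetteEdges p := by simp [he, plaquetteEdges]
  -- DLR at the single link `e`: it suffices to bound every one-link kernel mean from below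
  refine PlaquettePositivity.le_integral_of_isGibbsMeasure hγ hμ' {e} hXm hXabs fun η => ?_
  change _ ≤ siteAvg (perturbedYM (d := d) (fundamentalRep (Fin N)) (N * β) W supp) e X η
  rw [siteAvg_eq_integral_siteLaw hγ e hXm η, siteLaw_perturbedYM_eq_tilted_haar _ hρc _ hWm supp e η]
  -- the tilt has oscillation `≤ D`
  set D : ℝ := 4 * ((d : ℝ) - 1) * (N : ℝ) ^ 2 * |β| + ε₀ with hD
  set φ : SUN N → ℝ := fun g => perturbedEnergy (fundamentalRep (Fin N)) (N * β) W supp {e} (Function.update η e g) with hφ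
  have hφm : Measurable φ := (measurable_perturbedEnergy _ hρc _ hWm supp {e}).comp (measurable_update η)
  obtain ⟨lo, hlo⟩ := exists_window_of_osc (1 : SUN N) (V := φ) (a := D)
    (fun g g' => perturbedEnergy_singleton_osc hd1 hW e η g g')
  have hXup : Measurable fun g : SUN N => X (Function.update η e g) := hXm.comp (measurable_update η)
  have htilt := PlaquettePositivity.exp_neg_mul_integral_le_integral_tilted (ν := haarProbability (SUN N)) hXup
    (fun g => hX0 _) (fun g => hX4 _) hφm (a := lo) (D := D) (ae_of_all _ fun g => hlo g)
  refine le_trans ?_ htilt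
  exact mul_le_mul_of_nonneg_left (integral_haar_sq_sub_ge hN hep η m) (Real.exp_nonneg _)

/-- **The Wilson point, EVERY coupling, every DLR state**: `Var_μ(W_p) ≥ e^{−4(d−1)N²|β|} · V₀/N²` for every
`μ ∈ ymGibbsMeasures (fundamentalRep (Fin N)) (Nβ)`. [folklore] -/
theorem variance_plaquette_ge_wilson (hd : 2 ≤ d) (hN : 2 ≤ N) {β : ℝ} {μ : Measure (LGConfig d (SUN N))}
    (hμ : μ ∈ ymGibbsMeasures (d := d) (fundamentalRep (Fin N)) (N * β)) (p : ZdPlaquette d) :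
    Real.exp (-(4 * ((d : ℝ) - 1) * (N : ℝ) ^ 2 * |β|)) * (PlaquetteLowerBound.charVariance (fundamentalRep (Fin N)) / (N : ℝ) ^ 2) ≤
      Var[zdPlaquetteObs (fundamentalRep (Fin N)) p.1 p.2.1.1 p.2.1.2; μ] := by
  have hμ' : μ ∈ perturbedGibbsMeasures (d := d) (fundamentalRep (Fin N)) (N * β) 0
      (fun _ => (∅ : Finset (Finset (ZdEdge d)))) := by rwa [perturbedGibbsMeasures_zero]
  have h := variance_plaquette_ge_of_memBallZd hd hN (memBallZd_zero (N := N) (ε₀ := 0) (ε₁ := 0) (R := 0) le_rfl le_rfl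
    (supp := fun _ => (∅ : Finset (Finset (ZdEdge d)))) fun _ _ h => by simp at h) hμ' p
  simpa only [add_zero] using h

/-! ### Cells -/

/-- **Every `N ≥ 2`: `Var_μ(W_p) ≥ e^{−(4(d−1)N²|β| + ε₀)}/(2N²)`** on the tier-1 ball (`V₀ ≥ 1/2`, `half_le_charVariance`). [folklore] -/
theorem suN_variance_plaquette_ge (hd : 2 ≤ d) (hN : 2 ≤ N) {β ε₀ ε₁ R : ℝ} {W : Potential (ZdEdge d) (SUN N)}
    {supp : Finset (ZdEdge d) → Finset (Finset (ZdEdge d))} (hW : MemBallZd ε₀ ε₁ R W supp)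
    {μ : Measure (LGConfig d (SUN N))} (hμ : μ ∈ perturbedGibbsMeasures (d := d) (fundamentalRep (Fin N)) (N * β) W supp)
    (p : ZdPlaquette d) :
    Real.exp (-(4 * ((d : ℝ) - 1) * (N : ℝ) ^ 2 * |β| + ε₀)) / (2 * (N : ℝ) ^ 2) ≤
      Var[zdPlaquetteObs (fundamentalRep (Fin N)) p.1 p.2.1.1 p.2.1.2; μ] := by
  refine le_trans ?_ (variance_plaquette_ge_of_memBallZd hd hN hW hμ p)
  have hV := HaarSecondMoments.half_le_charVariance (fundamentalRep (Fin N)) (TorusAreaLaw.isSpecialUnitaryModel_fundamentalRep N) hN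
  have hN0 : (0 : ℝ) < (N : ℝ) ^ 2 := by positivity
  rw [div_eq_mul_one_div _ (2 * (N : ℝ) ^ 2)]
  refine mul_le_mul_of_nonneg_left ?_ (Real.exp_nonneg _)
  rw [div_le_div_iff₀ (by positivity) hN0]
  nlinarith

/-- **`SU(2)`, `d = 4`, on the ball** ('t Hooft `β_W/4`, `V₀ = 1`): every member of `MemBallZd ε₀ ε₁ R`, every DLR state, every plaquette:
`Var_μ(½ Re tr U_p) ≥ e^{−(12|β_W| + ε₀)}/4`. [folklore] -/
theorem su2_variance_plaquette_ge {βW ε₀ ε₁ R : ℝ} {W : Potential (ZdEdge 4) (SUN 2)}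
    {supp : Finset (ZdEdge 4) → Finset (Finset (ZdEdge 4))} (hW : MemBallZd ε₀ ε₁ R W supp)
    {μ : Measure (LGConfig 4 (SUN 2))} (hμ : μ ∈ perturbedGibbsMeasures (d := 4) (fundamentalRep (Fin 2)) (2 * (βW / 4)) W supp)
    (p : ZdPlaquette 4) :
    Real.exp (-(12 * |βW| + ε₀)) / 4 ≤ Var[zdPlaquetteObs (fundamentalRep (Fin 2)) p.1 p.2.1.1 p.2.1.2; μ] := by
  have h := variance_plaquette_ge_of_memBallZd (d := 4) (N := 2) (by norm_num) (by norm_num) hW hμ p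
  rw [HaarSecondMoments.charVariance_su2] at h
  have e1 : (4 * (((4 : ℕ) : ℝ) - 1) * ((2 : ℕ) : ℝ) ^ 2 * |βW / 4| + ε₀) = 12 * |βW| + ε₀ := by
    rw [abs_div, abs_of_pos (by norm_num : (0 : ℝ) < 4)]; push_cast; ring
  have e2 : (1 : ℝ) / ((2 : ℕ) : ℝ) ^ 2 = 1 / 4 := by norm_num
  rw [e1, e2] at h
  rw [div_eq_mul_one_div]
  exact h

/-- **`SU(2)`, `d = 4`, THE WILSON POINT, EVERY `β_W`, EVERY DLR STATE**: `Var_μ(½ Re tr U_p) ≥ e^{−12|β_W|}/4` for every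
`μ ∈ ymGibbsMeasures (fundamentalRep (Fin 2)) (β_W/2)`. [folklore] -/
theorem su2_variance_plaquette_ge_wilson {βW : ℝ} {μ : Measure (LGConfig 4 (SUN 2))}
    (hμ : μ ∈ ymGibbsMeasures (d := 4) (fundamentalRep (Fin 2)) (βW / 2)) (p : ZdPlaquette 4) :
    Real.exp (-(12 * |βW|)) / 4 ≤ Var[zdPlaquetteObs (fundamentalRep (Fin 2)) p.1 p.2.1.1 p.2.1.2; μ] := by
  have hμ' : μ ∈ perturbedGibbsMeasures (d := 4) (fundamentalRep (Fin 2)) (2 * (βW / 4)) 0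
      (fun _ => (∅ : Finset (Finset (ZdEdge 4)))) := by
    rw [perturbedGibbsMeasures_zero]
    have e : (2 : ℝ) * (βW / 4) = βW / 2 := by ring
    rwa [e]
  have h := su2_variance_plaquette_ge (memBallZd_zero (N := 2) (ε₀ := 0) (ε₁ := 0) (R := 0) le_rfl le_rfl
    (supp := fun _ => (∅ : Finset (Finset (ZdEdge 4)))) fun _ _ h => by simp at h) hμ' p
  simpa only [add_zero] using h

end Member

end Summit.Ventures.YMGap.RobustBall

end
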